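import Literature.NumberTheory.NumberFields.RayClassFieldLocalTowerDisjoint
import Literature.NumberTheory.NumberFields.RayClassFieldLocalTowerNormUnramified
import Literature.NumberTheory.GaloisRepresentations.CompletionCompositumEmbedding
import HarnessLib

/-!
# THE COMPLETION OF `K(𝔪v^{n+1})` AT THE PRIME CUT OUT BY `ι : K̄ → K̄_v` IS THE LUBIN–TATE TOWER FIELD `E·K_π^{n+1}`:
# `K_v·ι(K(𝔪v^{n+1})) = E ⊔ ltField π n` as subfields of `K̄_v`, and `E·K_π^{n+1} ≃ₐ[K_v] K(𝔪v^{n+1})_𝔓` — de Shalit II.1.10 at the split prime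

Setting of `RayClassFieldLocalTowerContainment.lean` / `…Disjoint.lean` (`K` a number field, `𝔪 ≠ 0`, `v ∤ 𝔪`, `w_𝔪 = 1`, a uniformiser
`π` of `K_v`, `α ∈ 𝓞_K` with `α ≡ 1 mod 𝔪`, `(α) = 𝔭_v^f`, `α = π^f` in `K_v` — the ABSOLUTE Lubin–Tate model — and a finite `E ≤ K_v^{nr}`
with `f ∣ deg w` for the Weil elements fixing `E`).  De Shalit II.1.10 Lemma: the completion of `K(𝔣𝔭^{n+1})` at a prime `𝔓 ∣ 𝔭` is
`Φ·k_ξ^{n+1}`, `Φ = K(𝔣)_𝔓` unramified of degree `f = ord [𝔭] ∈ Cl(𝔣)`.  The tree has the two inclusions in GALOIS FORM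
(`absClosureEmbedding_mem_sup_ltField_of_mem_rayClassField_mul_pow`: `ι(K(𝔪v^{n+1})) ⊆ E·K_π^{n+1}`;
`mem_fixingSubgroup_sup_ltField_of_forall_smul_absClosureEmbedding_eq` + the INERT criterion
`mem_fixingSubgroup_of_forall_smul_absClosureEmbedding_eq_of_finrank_dvd_orderOf`: an automorphism fixing `ι(K(𝔪v^{n+1}))` fixes `E·K_π^{n+1}`
once `[E:K_v] ∣ ord Frob_v(K(𝔪)/K)`), and the compositum model of completions (`SemiLocal.compositum`, `embPlace`, `compositumEquivEmb`:
`K_v·ι(F) ≃ₐ[K_v] F_{w_v}` at the distinguished place `w_v` cut out by `ι`, `CompletionCompositumEmbedding`).  THIS file assembles them: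

* §1 ★ `compositum_rayClassField_mul_pow_le` — `K_v·ι(K(𝔪v^{n+1})) ≤ E ⊔ ltField π n`;
* §2 ★ `sup_ltField_le_compositum_rayClassField_mul_pow` — `E ⊔ ltField π n ≤ K_v·ι(K(𝔪v^{n+1}))` (given `w_𝔪 = 1`, `E ≤ K_v^{nr}`,
  `[E:K_v] ∣ ord Frob_v(K(𝔪)/K)`; Galois correspondence for `K̄_v/K_v`, `InfiniteGalois.fixedField_fixingSubgroup`);
* §3 ★★★ **`compositum_rayClassField_mul_pow_eq`** — **`K_v·ι(K(𝔪v^{n+1})) = E ⊔ ltField π n`** as intermediate fields of `K̄_v/K_v`;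
* §4 ★★ **`supLtFieldEquivAdicCompletion … n : (E ⊔ ltField π n) ≃ₐ[K_v] K(𝔪v^{n+1})_{𝔓_n}`**, `𝔓_n := embPlace v (K(𝔪v^{n+1})).val` the prime
  above `v` cut out by `ι`, with ★ `supLtFieldEquivAdicCompletion_apply_mk` (**`ψ_n(ι x) = x`** for GLOBAL `x ∈ K(𝔪v^{n+1})`), `…_symm_algebraMap`,
  and `finrank_sup_ltField_eq_finrank_adicCompletion` (`[E·K_π^{n+1} : K_v] = [K(𝔪v^{n+1})_{𝔓_n} : K_v]`, the local degree).

So the principal units `U¹(K(𝔪v^{n+1})_{𝔓_n})` of Rubin's semi-local factor ARE (via `ψ_n` and `SemiLocal.unitBallEquivAdicCompletionIntegers`,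
`CompletionCompositumUnitBall`) the principal units of the Lubin–Tate tower field `E·K_π^{n+1}` — the layer-`n` carrier of the tree's
`RelNormCoherentUnits hπ E` / `principalCoherentFamilies` — and by `CompletionCompositumTower.algHom_compositum_norm` the local norms of the
`𝔓`-tower are the `towerAlgebra`-norms.  For de Shalit's two-variable tower take `𝔪 := 𝔤₀v̄^{a+i+1}`, `E := E_{i+c}`
(`RayClassFieldTwoVariableTowerDataOffset`: `towerDataOffset_hdegE`, `towerDataOffset_hinert` supply `hdegE` and the divisibility).
Cell `bsd-print-cf2`, brick §4(c)/(e), dictionary item D2 «local model» LM3 (memo BRICK-C-ORBITS-g22 §3).  One definition (`supLtFieldEquivAdicCompletion`, a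
composition of `IntermediateField.equivOfEq` and `compositumEquivEmb`), theorems otherwise; no named fact, no instance, no `sorry`.

## References
* [deShalit1987] E. de Shalit, *Iwasawa theory of elliptic curves with complex multiplication* (1987), I.1.8 (p. 11), II.1.10 Lemma and Corollary
  (p. 39), II.4.3–4.5 (p. 57–58), II.4.14 Step 1 (p. 71).
* [NeukirchANT1999] J. Neukirch, *Algebraic Number Theory* (1999), Ch. II (8.1)–(8.3), Ch. VI §5 Prop. (5.6), §7 Thm. (7.1), Cor. (7.3).
* [CasselsFrohlichANT1967] Cassels–Fröhlich (1967), Ch. II §10 ("`L_w = K_v L`"), Ch. VI §3.6 Prop. 6.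
-/

noncomputable section

open NumberField IsDedekindDomain IsDedekindDomain.HeightOneSpectrum Field
open scoped nonZeroDivisors Classical

namespace Literature.NumberTheory.NumberFields

open Literature.NumberTheory.GaloisRepresentations
open Literature.NumberTheory.GaloisRepresentations.ArtinLocalGlobal
open Literature.NumberTheory.GaloisRepresentations.IsNonarchimedeanLocalField
open ValuativeRel

variable {K : Type} [Field K] [NumberField K] {𝔪 : Ideal (𝓞 K)} {v : HeightOneSpectrum (𝓞 K)}

/-! ### §0. Two bookkeeping lemmas on the compositum -/

/-- `ι(K(𝔪)) ⊆ K_v·ι(K(𝔪'))` for `K(𝔪) ≤ K(𝔪')`. [cite: CasselsFrohlichANT1967, Ch. II §10] -/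
theorem absClosureEmbedding_mem_compositum_of_le {L L' : IntermediateField K (AlgebraicClosure K)} (hLL' : L ≤ L') {x : AlgebraicClosure K}
    (hx : x ∈ L) : absClosureEmbedding K (v.adicCompletion K) x ∈ SemiLocal.compositum L'.val v :=
  IntermediateField.subset_adjoin _ _ ⟨⟨x, hLL' hx⟩, rfl⟩

/-- An automorphism of `K̄_v/K_v` fixing the compositum `K_v·ι(L')` pointwise fixes `ι x` for every `x ∈ L ≤ L'`. [cite: CasselsFrohlichANT1967, Ch. II §10] -/
theorem smul_absClosureEmbedding_eq_of_mem_fixingSubgroup_compositum {L L' : IntermediateField K (AlgebraicClosure K)} (hLL' : L ≤ L')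
    {τ : absoluteGaloisGroup (v.adicCompletion K)} (hτ : τ ∈ (SemiLocal.compositum L'.val v).fixingSubgroup)
    (x : AlgebraicClosure K) (hx : x ∈ L) :
    τ • absClosureEmbedding K (v.adicCompletion K) x = absClosureEmbedding K (v.adicCompletion K) x :=
  (IntermediateField.mem_fixingSubgroup_iff _ _).1 hτ _ (absClosureEmbedding_mem_compositum_of_le hLL' hx)

variable [IsTotallyComplex K]

/-! ### §1. `K_v·ι(K(𝔪v^{n+1})) ≤ E ⊔ ltField π n` -/

/-- ★ **`K_v·ι(K(𝔪v^{n+1})) ≤ E·K_π^{n+1}`**: the compositum generated over `K_v` by the image of the ray class field lies in the Lubin–Tate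
tower field (the generators do: `absClosureEmbedding_mem_sup_ltField_of_mem_rayClassField_mul_pow`). [cite: deShalit1987, II.1.10 Lemma (p. 39)] -/
theorem compositum_rayClassField_mul_pow_le (h𝔪 : 𝔪 ≠ ⊥) (hv : ¬ 𝔪 ≤ v.asIdeal)
    {π : 𝒪[v.adicCompletion K]} (hπ : (valuation (v.adicCompletion K)).IsUniformizer (π : v.adicCompletion K))
    {α : 𝓞 K} (hα0 : α ≠ 0) (hα𝔪 : α - 1 ∈ 𝔪) (hαw : ∀ w : HeightOneSpectrum (𝓞 K), w ≠ v → α ∉ w.asIdeal)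
    {f : ℕ} (hαπ : ((α : K) : v.adicCompletion K) = (π : v.adicCompletion K) ^ f)
    (E : IntermediateField (v.adicCompletion K) (AlgebraicClosure (v.adicCompletion K)))
    [FiniteDimensional (v.adicCompletion K) E] [Normal (v.adicCompletion K) E]
    (hdegE : ∀ w : WeilGroup (v.adicCompletion K),
      WeilGroup.toAbsGalois (v.adicCompletion K) w ∈ E.fixingSubgroup → (f : ℤ) ∣ WeilGroup.deg w)
    (n : ℕ) :
    SemiLocal.compositum (rayClassField K (𝔪 * v.asIdeal ^ (n + 1))).val v ≤
      (E ⊔ ltField π n : IntermediateField (v.adicCompletion K) (AlgebraicClosure (v.adicCompletion K))) := by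
  rw [SemiLocal.compositum, IntermediateField.adjoin_le_iff]
  rintro _ ⟨x, rfl⟩
  exact absClosureEmbedding_mem_sup_ltField_of_mem_rayClassField_mul_pow h𝔪 hv hπ hα0 hα𝔪 hαw hαπ E hdegE n x.2

/-! ### §2. `E ⊔ ltField π n ≤ K_v·ι(K(𝔪v^{n+1}))` -/

/-- ★ **`E·K_π^{n+1} ≤ K_v·ι(K(𝔪v^{n+1}))`** (`w_𝔪 = 1`, `E ≤ K_v^{nr}`, `[E:K_v] ∣ f₀ := ord Frob_v(K(𝔪)/K)`): an automorphism of `K̄_v/K_v`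
fixing `ι(K(𝔪v^{n+1}))` fixes `ι(K(𝔪))`, hence `E` (the INERT criterion), hence `E ⊔ ltField π n` (linear disjointness, Galois form); and a
subfield of `K̄_v` is the fixed field of its fixing subgroup. [cite: deShalit1987, II.1.10 Lemma and Corollary (p. 39)]
[cite: NeukirchANT1999, Ch. VI §7 Cor. (7.3)] -/
theorem sup_ltField_le_compositum_rayClassField_mul_pow (h𝔪 : 𝔪 ≠ ⊥) (hv : ¬ 𝔪 ≤ v.asIdeal)
    (hw : ∀ u : (𝓞 K)ˣ, (u : 𝓞 K) - 1 ∈ 𝔪 → u = 1)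
    {π : 𝒪[v.adicCompletion K]} (hπ : (valuation (v.adicCompletion K)).IsUniformizer (π : v.adicCompletion K))
    {α : 𝓞 K} (hα0 : α ≠ 0) (hα𝔪 : α - 1 ∈ 𝔪) (hαw : ∀ w : HeightOneSpectrum (𝓞 K), w ≠ v → α ∉ w.asIdeal)
    {f : ℕ} (hαπ : ((α : K) : v.adicCompletion K) = (π : v.adicCompletion K) ^ f)
    (E : IntermediateField (v.adicCompletion K) (AlgebraicClosure (v.adicCompletion K)))
    [FiniteDimensional (v.adicCompletion K) E] (hE : E ≤ maxUnramified (v.adicCompletion K))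
    (hdegE : ∀ w : WeilGroup (v.adicCompletion K),
      WeilGroup.toAbsGalois (v.adicCompletion K) w ∈ E.fixingSubgroup → (f : ℤ) ∣ WeilGroup.deg w)
    (hdvd : ((Module.finrank (v.adicCompletion K) E : ℕ) : ℤ) ∣
      (orderOf (abRestrict (rayClassField K 𝔪)
        (ideleArtinMap K (localUnits v (Units.mk0 (π : v.adicCompletion K) hπ.ne_zero)))) : ℤ))
    (n : ℕ) :
    (E ⊔ ltField π n : IntermediateField (v.adicCompletion K) (AlgebraicClosure (v.adicCompletion K))) ≤
      SemiLocal.compositum (rayClassField K (𝔪 * v.asIdeal ^ (n + 1))).val v := by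
  haveI : CharZero (v.adicCompletion K) :=
    charZero_of_injective_algebraMap (algebraMap K (v.adicCompletion K)).injective
  haveI : IsGalois (v.adicCompletion K) (AlgebraicClosure (v.adicCompletion K)) :=
    IsAlgClosure.isGalois (v.adicCompletion K) (AlgebraicClosure (v.adicCompletion K))
  have hle : rayClassField K 𝔪 ≤ rayClassField K (𝔪 * v.asIdeal ^ (n + 1)) :=
    rayClassField_le_of_le (mul_ne_zero h𝔪 (pow_ne_zero _ v.ne_bot)) Ideal.mul_le_right
  intro x hx
  rw [← InfiniteGalois.fixedField_fixingSubgroup (SemiLocal.compositum (rayClassField K (𝔪 * v.asIdeal ^ (n + 1))).val v),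
    IntermediateField.mem_fixedField_iff]
  intro τ hτ
  -- `τ` fixes `ι(K(𝔪))`, hence `E` (inert criterion), hence `E ⊔ ltField π n`
  have hτE : τ ∈ E.fixingSubgroup :=
    mem_fixingSubgroup_of_forall_smul_absClosureEmbedding_eq_of_finrank_dvd_orderOf h𝔪 hv hπ E hE hdvd
      fun y hy ↦ smul_absClosureEmbedding_eq_of_mem_fixingSubgroup_compositum hle hτ y hy
  have hτ' := mem_fixingSubgroup_sup_ltField_of_forall_smul_absClosureEmbedding_eq h𝔪 hv hw hπ hα0 hα𝔪 hαw hαπ E hdegE n hτE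
    fun y hy ↦ smul_absClosureEmbedding_eq_of_mem_fixingSubgroup_compositum le_rfl hτ y hy
  exact (IntermediateField.mem_fixingSubgroup_iff _ _).1 hτ' x hx

/-! ### §3. Equality -/

/-- ★★★ **`K_v·ι(K(𝔪v^{n+1})) = E·K_π^{n+1}` in `K̄_v`** — de Shalit II.1.10 at the split prime: the completion of the `𝔭`-division ray class field
`K(𝔪𝔭^{n+1})` at the prime cut out by `ι : K̄ → K̄_v`, realised as the compositum inside `K̄_v`, IS the Lubin–Tate tower field `E ⊔ ltField π n` over the
unramified base `E` of degree `f₀ = ord [𝔭_v] ∈ Cl(𝔪)` (hypotheses: `w_𝔪 = 1`; `α ≡ 1 mod 𝔪`, `(α) = 𝔭_v^f`, `α = π^f`; `E ≤ K_v^{nr}` finite normal with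
`f ∣ deg w` on `Γ_E` and `[E:K_v] ∣ f₀`). [cite: deShalit1987, II.1.10 Lemma and Corollary (p. 39), I.1.8 (p. 11)] [cite: NeukirchANT1999, Ch. VI §7 Cor. (7.3)] -/
theorem compositum_rayClassField_mul_pow_eq (h𝔪 : 𝔪 ≠ ⊥) (hv : ¬ 𝔪 ≤ v.asIdeal)
    (hw : ∀ u : (𝓞 K)ˣ, (u : 𝓞 K) - 1 ∈ 𝔪 → u = 1)
    {π : 𝒪[v.adicCompletion K]} (hπ : (valuation (v.adicCompletion K)).IsUniformizer (π : v.adicCompletion K))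
    {α : 𝓞 K} (hα0 : α ≠ 0) (hα𝔪 : α - 1 ∈ 𝔪) (hαw : ∀ w : HeightOneSpectrum (𝓞 K), w ≠ v → α ∉ w.asIdeal)
    {f : ℕ} (hαπ : ((α : K) : v.adicCompletion K) = (π : v.adicCompletion K) ^ f)
    (E : IntermediateField (v.adicCompletion K) (AlgebraicClosure (v.adicCompletion K)))
    [FiniteDimensional (v.adicCompletion K) E] [Normal (v.adicCompletion K) E] (hE : E ≤ maxUnramified (v.adicCompletion K))
    (hdegE : ∀ w : WeilGroup (v.adicCompletion K),
      WeilGroup.toAbsGalois (v.adicCompletion K) w ∈ E.fixingSubgroup → (f : ℤ) ∣ WeilGroup.deg w)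
    (hdvd : ((Module.finrank (v.adicCompletion K) E : ℕ) : ℤ) ∣
      (orderOf (abRestrict (rayClassField K 𝔪)
        (ideleArtinMap K (localUnits v (Units.mk0 (π : v.adicCompletion K) hπ.ne_zero)))) : ℤ))
    (n : ℕ) :
    SemiLocal.compositum (rayClassField K (𝔪 * v.asIdeal ^ (n + 1))).val v =
      (E ⊔ ltField π n : IntermediateField (v.adicCompletion K) (AlgebraicClosure (v.adicCompletion K))) :=
  le_antisymm (compositum_rayClassField_mul_pow_le h𝔪 hv hπ hα0 hα𝔪 hαw hαπ E hdegE n)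
    (sup_ltField_le_compositum_rayClassField_mul_pow h𝔪 hv hw hπ hα0 hα𝔪 hαw hαπ E hE hdegE hdvd n)

/-! ### §4. `E·K_π^{n+1} ≃ₐ[K_v] K(𝔪v^{n+1})_𝔓` at the distinguished prime `𝔓 = 𝔓_n` cut out by `ι` -/

section Equiv

variable (h𝔪 : 𝔪 ≠ ⊥) (hv : ¬ 𝔪 ≤ v.asIdeal) (hw : ∀ u : (𝓞 K)ˣ, (u : 𝓞 K) - 1 ∈ 𝔪 → u = 1)
  {π : 𝒪[v.adicCompletion K]} (hπ : (valuation (v.adicCompletion K)).IsUniformizer (π : v.adicCompletion K))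
  {α : 𝓞 K} (hα0 : α ≠ 0) (hα𝔪 : α - 1 ∈ 𝔪) (hαw : ∀ w : HeightOneSpectrum (𝓞 K), w ≠ v → α ∉ w.asIdeal)
  {f : ℕ} (hαπ : ((α : K) : v.adicCompletion K) = (π : v.adicCompletion K) ^ f)
  (E : IntermediateField (v.adicCompletion K) (AlgebraicClosure (v.adicCompletion K)))
  [FiniteDimensional (v.adicCompletion K) E] [Normal (v.adicCompletion K) E] (hE : E ≤ maxUnramified (v.adicCompletion K))
  (hdegE : ∀ w : WeilGroup (v.adicCompletion K),
    WeilGroup.toAbsGalois (v.adicCompletion K) w ∈ E.fixingSubgroup → (f : ℤ) ∣ WeilGroup.deg w)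
  (hdvd : ((Module.finrank (v.adicCompletion K) E : ℕ) : ℤ) ∣
    (orderOf (abRestrict (rayClassField K 𝔪)
      (ideleArtinMap K (localUnits v (Units.mk0 (π : v.adicCompletion K) hπ.ne_zero)))) : ℤ))
  (n : ℕ)

/-- ★★ **`ψ_n : E·K_π^{n+1} ≃ₐ[K_v] K(𝔪v^{n+1})_{𝔓_n}`**, `𝔓_n = embPlace v (K(𝔪v^{n+1})).val` the prime of `K(𝔪v^{n+1})` above `v` cut out by `ι`:
the equality of §3 followed by the compositum isomorphism `compositumEquivEmb` of `CompletionCompositumEmbedding`.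
[cite: deShalit1987, II.1.10 Lemma (p. 39)] [cite: CasselsFrohlichANT1967, Ch. II §10] -/
def supLtFieldEquivAdicCompletion :
    (E ⊔ ltField π n : IntermediateField (v.adicCompletion K) (AlgebraicClosure (v.adicCompletion K))) ≃ₐ[v.adicCompletion K]
      ((SemiLocal.embPlace v (rayClassField K (𝔪 * v.asIdeal ^ (n + 1))).val : HeightOneSpectrum (𝓞 (rayClassField K (𝔪 * v.asIdeal ^ (n + 1))))).adicCompletion (rayClassField K (𝔪 * v.asIdeal ^ (n + 1)))) :=
  (IntermediateField.equivOfEq (compositum_rayClassField_mul_pow_eq h𝔪 hv hw hπ hα0 hα𝔪 hαw hαπ E hE hdegE hdvd n).symm).trans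
    (SemiLocal.compositumEquivEmb v (rayClassField K (𝔪 * v.asIdeal ^ (n + 1))).val)

/-- Unfolding: `ψ_n y = compositumEquivEmb (y)` (the same element, re-typed along the equality of §3). [cite: CasselsFrohlichANT1967, Ch. II §10] -/
theorem supLtFieldEquivAdicCompletion_apply (y : (E ⊔ ltField π n : IntermediateField (v.adicCompletion K) (AlgebraicClosure (v.adicCompletion K)))) :
    supLtFieldEquivAdicCompletion h𝔪 hv hw hπ hα0 hα𝔪 hαw hαπ E hE hdegE hdvd n y =
      SemiLocal.compositumEquivEmb v (rayClassField K (𝔪 * v.asIdeal ^ (n + 1))).val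
        (IntermediateField.equivOfEq (compositum_rayClassField_mul_pow_eq h𝔪 hv hw hπ hα0 hα𝔪 hαw hαπ E hE hdegE hdvd n).symm y) :=
  AlgEquiv.trans_apply _ _ y

/-- The re-typing along the equality of §3 does not move elements: `(equivOfEq _ y : K̄_v) = y`. [cite: CasselsFrohlichANT1967, Ch. II §10] -/
theorem coe_equivOfEq_compositum_apply (y : (E ⊔ ltField π n : IntermediateField (v.adicCompletion K) (AlgebraicClosure (v.adicCompletion K)))) :
    ((IntermediateField.equivOfEq (compositum_rayClassField_mul_pow_eq h𝔪 hv hw hπ hα0 hα𝔪 hαw hαπ E hE hdegE hdvd n).symm y :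
        SemiLocal.compositum (rayClassField K (𝔪 * v.asIdeal ^ (n + 1))).val v) : AlgebraicClosure (v.adicCompletion K)) = y := by
  rw [IntermediateField.equivOfEq]
  exact congrArg Subtype.val (Subalgebra.equivOfEq_apply _ _ _ y)

/-- ★ **GLOBAL elements: `ψ_n(ι x) = x`** for `x ∈ K(𝔪v^{n+1})` — the isomorphism extends the embedding of the global field into its completion.
[cite: CasselsFrohlichANT1967, Ch. II §10] [cite: NeukirchANT1999, Ch. II (8.1)–(8.3)] -/
theorem supLtFieldEquivAdicCompletion_apply_mk (x : rayClassField K (𝔪 * v.asIdeal ^ (n + 1))) :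
    supLtFieldEquivAdicCompletion h𝔪 hv hw hπ hα0 hα𝔪 hαw hαπ E hE hdegE hdvd n
        ⟨absClosureEmbedding K (v.adicCompletion K) x,
          absClosureEmbedding_mem_sup_ltField_of_mem_rayClassField_mul_pow h𝔪 hv hπ hα0 hα𝔪 hαw hαπ E hdegE n x.2⟩ =
      algebraMap (rayClassField K (𝔪 * v.asIdeal ^ (n + 1))) _ x := by
  rw [supLtFieldEquivAdicCompletion_apply]
  exact (congrArg (SemiLocal.compositumEquivEmb v (rayClassField K (𝔪 * v.asIdeal ^ (n + 1))).val) (Subtype.ext rfl)).trans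
    (SemiLocal.compositumEquivEmb_apply_mk v (rayClassField K (𝔪 * v.asIdeal ^ (n + 1))).val x)

/-- `ψ_n⁻¹(x) = ι x` for global `x ∈ K(𝔪v^{n+1})`. [cite: CasselsFrohlichANT1967, Ch. II §10] -/
theorem supLtFieldEquivAdicCompletion_symm_algebraMap (x : rayClassField K (𝔪 * v.asIdeal ^ (n + 1))) :
    (((supLtFieldEquivAdicCompletion h𝔪 hv hw hπ hα0 hα𝔪 hαw hαπ E hE hdegE hdvd n).symm
        (algebraMap (rayClassField K (𝔪 * v.asIdeal ^ (n + 1))) _ x) :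
        (E ⊔ ltField π n : IntermediateField (v.adicCompletion K) (AlgebraicClosure (v.adicCompletion K)))) :
      AlgebraicClosure (v.adicCompletion K)) = absClosureEmbedding K (v.adicCompletion K) x := by
  rw [← supLtFieldEquivAdicCompletion_apply_mk h𝔪 hv hw hπ hα0 hα𝔪 hαw hαπ E hE hdegE hdvd n x, AlgEquiv.symm_apply_apply]

include h𝔪 hv hw hα0 hα𝔪 hαw hαπ hE hdegE hdvd in
/-- **`[E·K_π^{n+1} : K_v] = [K(𝔪v^{n+1})_{𝔓_n} : K_v]`** — the degree of the Lubin–Tate tower field is the local degree of the ray class field at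
`𝔓_n`. [cite: deShalit1987, II.1.10 Corollary (p. 39)] -/
theorem finrank_sup_ltField_eq_finrank_adicCompletion :
    Module.finrank (v.adicCompletion K) (E ⊔ ltField π n : IntermediateField (v.adicCompletion K) (AlgebraicClosure (v.adicCompletion K))) =
      Module.finrank (v.adicCompletion K)
        ((SemiLocal.embPlace v (rayClassField K (𝔪 * v.asIdeal ^ (n + 1))).val : HeightOneSpectrum (𝓞 (rayClassField K (𝔪 * v.asIdeal ^ (n + 1))))).adicCompletion (rayClassField K (𝔪 * v.asIdeal ^ (n + 1)))) :=
  (supLtFieldEquivAdicCompletion h𝔪 hv hw hπ hα0 hα𝔪 hαw hαπ E hE hdegE hdvd n).toLinearEquiv.finrank_eq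

end Equiv

end Literature.NumberTheory.NumberFields

end
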